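import Summits.RiemannHypothesis.RiemannHypothesis.Theorems.PfPersistenceF1TemplateMellin
import Summits.RiemannHypothesis.RiemannHypothesis.Theorems.PfPersistenceF1CriticalLine
import Literature.NumberTheory.LFunctions.LevinsonMontgomery

/-!
# PF persistence, fake seat 1 — the continued transform `N_t` at the abscissa

Unit `pub-rhpf-fake-1` of the `pub-rhpf` cell (mechanism / rigidity campaign; **no RH claims**);
continuation of `PfPersistenceF1TemplateMellin` (FAKES §1.8.3′, THEOREM F1-T₁).  For the continued
Mellin transform `N_t(s) = A(t) + 4/(1+4t²) + ζ₁'/ζ₁(s + 1/2 + it) + ζ₁'/ζ₁(s + 1/2 − it)` of the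
template line density: (i) `N_t(0) = 0` as soon as `ζ(1/2 + it) ≠ 0` — the kernel form of F1-S (a)
(`archWeight_eq_neg_two_mul_re_logDeriv`: the archimedean weight is `−2 Re ζ'/ζ(1/2+it)`), which is
what places the abscissa of the Landau argument at `Re ρ₀ − 1/2` even for a critical-line zero `ρ₀`;
(ii) `N_t` is analytic wherever `ζ₁(s + 1/2 ± it) ≠ 0`.  Unconditional; nothing about RH.
-/

set_option linter.dupNamespace false

noncomputable section

open Complex Filter Topology Set MeasureTheory

namespace Summit.RiemannHypothesis.RiemannHypothesis.Theorems.PfPersistence.Fake1.TemplateAbscissa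

open Literature.NumberTheory.LFunctions
open Summit.RiemannHypothesis.RiemannHypothesis.Theorems.PfPersistence.Fake1.TemplateMellin

/-! ## The value `N_t(0) = 0` (F1-S (a)) and regularity of `N_t` off the zeros -/

/-- `w₁ − 1 ≠ 0`, `w₀ − 1 ≠ 0`, and `(w₁ − 1)⁻¹ + (w₀ − 1)⁻¹ = −4/(1 + 4t²)`. [folklore] -/
theorem inv_wone_sub_one_add (t : ℝ) :
    (wone t - 1)⁻¹ + (wzero t - 1)⁻¹ = -(4 / (1 + 4 * (t : ℂ) ^ 2)) := by
  have h1 : wone t - 1 ≠ 0 := by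
    intro h; have := congrArg Complex.re h; norm_num [wone] at this
  have h2 : wzero t - 1 ≠ 0 := by
    intro h; have := congrArg Complex.re h; norm_num [wzero] at this
  have h3 : (1 + 4 * (t : ℂ) ^ 2) ≠ 0 := by
    have : (1 + 4 * (t : ℂ) ^ 2) = ((1 + 4 * t ^ 2 : ℝ) : ℂ) := by push_cast; ring
    rw [this, Ne, Complex.ofReal_eq_zero]; positivity
  field_simp
  simp only [wone, wzero]
  ring_nf
  rw [Complex.I_sq]
  ring

/-- **`N_t(0) = 0`** when `ζ(1/2 + it) ≠ 0`: by F1-S (a) (`archWeight_eq_neg_two_mul_re_logDeriv`: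
`A(t) = −2 Re ζ'/ζ(1/2+it)`), conjugation symmetry `ζ'/ζ(1/2−it) = conj ζ'/ζ(1/2+it)`, and
`(w₁−1)⁻¹ + (w₀−1)⁻¹ = −4/(1+4t²)`.  This is what puts the abscissa of the Landau argument at
`Re ρ₀ − 1/2` even when `Re ρ₀ = 1/2`. [folklore] -/
theorem tmplN_zero {t : ℝ} (hζ : riemannZeta (1 / 2 + t * I) ≠ 0) : tmplN t 0 = 0 := by
  have hw1 : wone t = 1 / 2 + t * I := rfl
  have hw0 : wzero t = (starRingEnd ℂ) (1 / 2 + t * I) := by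
    rw [← hw1, ← conj_wzero, Complex.conj_conj]
  have hne1 : (1 / 2 + t * I : ℂ) ≠ 1 := by
    intro h; have := congrArg Complex.re h; norm_num at this
  have hne0 : wzero t ≠ 1 := by
    intro h; have := congrArg Complex.re h; norm_num [wzero] at this
  have hζ0 : riemannZeta (wzero t) ≠ 0 := by
    rw [hw0, riemannZeta_conj]; exact (map_ne_zero _).2 hζ
  have hL1 : logDeriv riemannZeta₁ (wone t) =
      deriv riemannZeta (1 / 2 + t * I) / riemannZeta (1 / 2 + t * I) + (wone t - 1)⁻¹ := by
    rw [hw1, ← logDeriv_apply, logDeriv_riemannZeta_eq hne1 hζ]; ring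
  have hL0 : logDeriv riemannZeta₁ (wzero t) =
      (starRingEnd ℂ) (deriv riemannZeta (1 / 2 + t * I) / riemannZeta (1 / 2 + t * I)) +
        (wzero t - 1)⁻¹ := by
    have h := logDeriv_riemannZeta_eq hne0 hζ0
    rw [logDeriv_apply] at h
    have h' : deriv riemannZeta (wzero t) / riemannZeta (wzero t) =
        (starRingEnd ℂ) (deriv riemannZeta (1 / 2 + t * I) / riemannZeta (1 / 2 + t * I)) := by
      rw [hw0, riemannZeta_conj, deriv_riemannZeta_conj, map_div₀]
    rw [← h']
    linear_combination (-1 : ℂ) * h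
  have hA : (tmplA t : ℂ) =
      ((-2 * (deriv riemannZeta (1 / 2 + t * I) / riemannZeta (1 / 2 + t * I)).re : ℝ) : ℂ) := by
    unfold tmplA
    exact_mod_cast congrArg (fun r : ℝ ↦ (r : ℂ))
      (PfPersistence.Fake1.CriticalLine.archWeight_eq_neg_two_mul_re_logDeriv hζ)
  set L : ℂ := deriv riemannZeta (1 / 2 + t * I) / riemannZeta (1 / 2 + t * I) with hL
  have hLre : L + (starRingEnd ℂ) L = ((2 * L.re : ℝ) : ℂ) := Complex.add_conj L
  unfold tmplN
  rw [zero_add, zero_add, hL1, hL0, hA]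
  calc (((-2 * L.re : ℝ) : ℂ)) + 4 / (1 + 4 * (t : ℂ) ^ 2) + (L + (wone t - 1)⁻¹) +
        ((starRingEnd ℂ) L + (wzero t - 1)⁻¹)
      = ((-2 * L.re : ℝ) : ℂ) + (L + (starRingEnd ℂ) L) + 4 / (1 + 4 * (t : ℂ) ^ 2) +
          ((wone t - 1)⁻¹ + (wzero t - 1)⁻¹) := by ring
    _ = 0 := by rw [hLre, inv_wone_sub_one_add]; push_cast; ring

/-- `N_t` is analytic at every `s` with `ζ₁(s + w₁) ≠ 0` and `ζ₁(s + w₀) ≠ 0`. [folklore] -/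
theorem analyticAt_tmplN {t : ℝ} {s : ℂ} (h1 : riemannZeta₁ (s + wone t) ≠ 0)
    (h0 : riemannZeta₁ (s + wzero t) ≠ 0) : AnalyticAt ℂ (tmplN t) s := by
  unfold tmplN
  have hin1 : AnalyticAt ℂ (fun z : ℂ ↦ z + wone t) s := analyticAt_id.add analyticAt_const
  have hin0 : AnalyticAt ℂ (fun z : ℂ ↦ z + wzero t) s := analyticAt_id.add analyticAt_const
  have a1 : AnalyticAt ℂ (fun z ↦ logDeriv riemannZeta₁ (z + wone t)) s :=
    AnalyticAt.comp (g := logDeriv riemannZeta₁) (f := fun z : ℂ ↦ z + wone t) (x := s)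
      (PsiOneExplicit.analyticAt_logDeriv_riemannZeta₁ h1) hin1
  have a0 : AnalyticAt ℂ (fun z ↦ logDeriv riemannZeta₁ (z + wzero t)) s :=
    AnalyticAt.comp (g := logDeriv riemannZeta₁) (f := fun z : ℂ ↦ z + wzero t) (x := s)
      (PsiOneExplicit.analyticAt_logDeriv_riemannZeta₁ h0) hin0
  exact ((analyticAt_const.add analyticAt_const).add a1).add a0

end Summit.RiemannHypothesis.RiemannHypothesis.Theorems.PfPersistence.Fake1.TemplateAbscissa
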